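import Summits.AtomisticToContinuum.FouriersLaw.Theorems.VanishingNoiseTransferNoiseLocalityStubNoisyPositiveAux2
import Summits.AtomisticToContinuum.FouriersLaw.Theorems.OddSectorIrreversibilityBoundedResponseConvergesStubPositiveConductanceAux2

/-!
# Stub `stub_noisyPositive` of crux `NoiseLocality`, part 3: no smooth momentum-even solution of the
deterministic adjoint equation `L† U = -φ̃` in `L²(μ_T)`

Helper file `--supports stmt-AtomisticToContinuum-11975` (crux `NoiseLocality`, route
`VanishingNoiseTransfer`, line `relative-flip-energy-transfer`, stub `stub_noisyPositive`).

For the pinned anharmonic chain (`ω₂ > 0`, `lam ≥ 0`, `β ≥ 0`, `γ > 0`, `N ≥ 2`, `T > 0`), the McLennan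
source `φ̃ = γ(p_0² - p_{N-1}²)/(2T²)` and the momentum reversal `Θ(q,p) = (q,-p)`:

* `false_of_contDiff_even_adjoint_solution` — there is NO `U ∈ C²` with `U∘Θ = U`,
  `∫ U² e^{-H/T} < ∞` and `(L(U∘Θ))∘Θ = -φ̃` pointwise (`L = L_{T,T}`, so `(L(·∘Θ))∘Θ = L†` is the
  `L²(μ_T)`-adjoint). Proof: `Θ`-evenness turns the one equation into the pair
  `{H, U} = 0` (Liouville part) and `B U = -φ̃/γ` (bath part,
  `B = (T∂²_{p_0} - p_0∂_{p_0}) + (T∂²_{p_{N-1}} - p_{N-1}∂_{p_{N-1}})`); `V = U - (p_0² - p_{N-1}²)/(4T²)`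
  solves `B V = 0` in `L²`, hence `∂_{p_0}V = ∂_{p_{N-1}}V = 0` (part 2), i.e. `∂_{p_0}U = p_0/(2T²)`,
  `∂_{p_{N-1}}U = -p_{N-1}/(2T²)`; then `W = U - H/(2T²)` is a `C²` first integral of the CLOSED chain
  blind to `p_0`, so all its derivatives vanish (`poisson_hamiltonian_rigidity`, `V'' > 0`), while
  `∂_{p_{N-1}}W = -p_{N-1}/T² ≠ 0`;
* `ae_eq_comp_reversal_of_flips` — a function invariant a.e. under every single velocity flip
  `Θ_i` (for a flip-invariant measure) is a.e. `Θ`-invariant;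
* `integrable_mul_gibbsDensity_iff` — `F e^{-H/T} ∈ L¹(dx) ↔ F ∈ L¹(μ_T)`; the coordinate
  derivatives of `p_a² - p_b²`.

No definitions.
-/

noncomputable section

open MeasureTheory Filter Topology Set Function
open scoped ContDiff

namespace Summit.AtomisticToContinuum.FouriersLaw.Theorems.NoiseLocality.StubNoisyPositive

open Literature.MathematicalPhysics.KineticTheory.HeatConduction
open Summit.AtomisticToContinuum.FouriersLaw.Theorems.OddSectorIrreversibility
open Summit.AtomisticToContinuum.FouriersLaw.Theorems.SubdiffusiveBondHeat
open Summit.AtomisticToContinuum.FouriersLaw.Cruxes.BoundedResponseConverges.TwoScaleGluingLogRigidity.Stubs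

variable {N : ℕ}

/-! ### Conversions and symmetries -/

/-- `F e^{-H/T}` is Lebesgue integrable iff `F ∈ L¹(μ_T)` (pinned chain, `T > 0`). [folklore] -/
theorem integrable_mul_gibbsDensity_iff {ω₂ lam β : ℝ} (hω : 0 < ω₂) (hl : 0 ≤ lam) (hβ : 0 ≤ β)
    (γ : ℝ) (N : ℕ) {T : ℝ} (hT : 0 < T) (F : PhaseSpace N → ℝ) :
    Integrable (fun x => F x * (pinnedChain ω₂ lam β γ).gibbsDensity N T x) ↔
      Integrable F ((pinnedChain ω₂ lam β γ).gibbsMeasure N T) := by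
  have hρint : Integrable ((pinnedChain ω₂ lam β γ).gibbsDensity N T) :=
    pinnedChain_integrable_gibbsDensity hω hl hβ γ N hT
  rw [OscillatorChain.gibbsMeasure_eq, integrable_tilted_iff hρint]
  refine integrable_congr (ae_of_all _ fun x => ?_)
  simp only [smul_eq_mul, OscillatorChain.exp_neg_hamiltonian_div]
  ring

/-- **Single-flip invariance a.e. implies reversal invariance a.e.** If `μ` is invariant under every
velocity flip `Θ_i` and `U ∘ Θ_i = U` `μ`-a.e. for every `i`, then `U ∘ Θ = U` `μ`-a.e. for the global
momentum reversal `Θ(q,p) = (q,-p) = Θ_0 ∘ ⋯ ∘ Θ_{N-1}` (induction over the set of flipped sites).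
[folklore] -/
theorem ae_eq_comp_reversal_of_flips {μ : Measure (PhaseSpace N)}
    (hμ : ∀ i, MeasurePreserving (momentumFlip i) μ μ) {U : PhaseSpace N → ℝ}
    (hU : ∀ i, (fun x => U (momentumFlip i x)) =ᵐ[μ] U) :
    (fun x : PhaseSpace N => U (x.1, -x.2)) =ᵐ[μ] U := by
  classical
  suffices key : ∀ s : Finset (Fin N),
      MeasurePreserving (fun x : PhaseSpace N => ((x.1, fun j => if j ∈ s then -x.2 j else x.2 j) : PhaseSpace N))
        μ μ ∧
      (fun x : PhaseSpace N => U (x.1, fun j => if j ∈ s then -x.2 j else x.2 j)) =ᵐ[μ] U by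
    have h := (key Finset.univ).2
    have e : (fun x : PhaseSpace N => U (x.1, fun j => if j ∈ (Finset.univ : Finset (Fin N)) then -x.2 j else x.2 j)) =
        fun x : PhaseSpace N => U (x.1, -x.2) := by
      funext x
      simp only [Finset.mem_univ, if_true]
      rfl
    rw [e] at h
    exact h
  intro s
  induction s using Finset.induction_on with
  | empty =>
    have e : (fun x : PhaseSpace N => ((x.1, fun j => if j ∈ (∅ : Finset (Fin N)) then -x.2 j else x.2 j) : PhaseSpace N)) =
        id := by
      funext x
      simp only [Finset.notMem_empty, if_false, id_eq]
    refine ⟨?_, ?_⟩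
    · rw [e]; exact MeasurePreserving.id μ
    · exact Eventually.of_forall fun x => by simp only [Finset.notMem_empty, if_false]
  | insert i s hi ih =>
    obtain ⟨hmp, hae⟩ := ih
    have e : (fun x : PhaseSpace N => ((x.1, fun j => if j ∈ insert i s then -x.2 j else x.2 j) : PhaseSpace N)) =
        (momentumFlip i) ∘ fun x : PhaseSpace N => ((x.1, fun j => if j ∈ s then -x.2 j else x.2 j) : PhaseSpace N) := by
      funext x
      refine Prod.ext rfl (funext fun j => ?_)
      simp only [Function.comp_apply, momentumFlip_apply, Finset.mem_insert]
      by_cases hj : j = i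
      · subst hj
        simp [hi]
      · simp [hj]
    refine ⟨?_, ?_⟩
    · rw [e]; exact (hμ i).comp hmp
    · have h1 : (fun x : PhaseSpace N => U (momentumFlip i
          ((x.1, fun j => if j ∈ s then -x.2 j else x.2 j) : PhaseSpace N))) =ᵐ[μ]
          fun x : PhaseSpace N => U (x.1, fun j => if j ∈ s then -x.2 j else x.2 j) :=
        hmp.quasiMeasurePreserving.ae_eq_comp (hU i)
      have e' : (fun x : PhaseSpace N => U (x.1, fun j => if j ∈ insert i s then -x.2 j else x.2 j)) =
          fun x : PhaseSpace N => U (momentumFlip i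
            ((x.1, fun j => if j ∈ s then -x.2 j else x.2 j) : PhaseSpace N)) := by
        funext x
        have := congrFun e x
        simp only [Function.comp_apply] at this
        rw [← this]
      rw [e']
      exact h1.trans hae

/-! ### The quadratic momentum profile `E = p_a² - p_b²` -/

/-- `∂_{p_a}(p_a² - p_b²) = 2 p_a` for `a ≠ b`. [folklore] -/
theorem partialP_sqDiff_left {a b : Fin N} (hab : a ≠ b) (x : PhaseSpace N) :
    partialP a (fun y : PhaseSpace N => y.2 a ^ 2 - y.2 b ^ 2) x = 2 * x.2 a := by
  unfold partialP
  have e : (fun t : ℝ => (Function.update x.2 a t) a ^ 2 - (Function.update x.2 a t) b ^ 2) =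
      fun t : ℝ => t ^ 2 - x.2 b ^ 2 := by
    funext t
    rw [Function.update_self, Function.update_of_ne hab.symm]
  rw [e]
  have hd : HasDerivAt (fun t : ℝ => t ^ 2 - x.2 b ^ 2) (2 * x.2 a) (x.2 a) := by
    simpa using ((hasDerivAt_pow 2 (x.2 a)).sub_const (x.2 b ^ 2))
  exact hd.deriv

/-- `∂_{p_b}(p_a² - p_b²) = -2 p_b` for `a ≠ b`. [folklore] -/
theorem partialP_sqDiff_right {a b : Fin N} (hab : a ≠ b) (x : PhaseSpace N) :
    partialP b (fun y : PhaseSpace N => y.2 a ^ 2 - y.2 b ^ 2) x = -(2 * x.2 b) := by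
  unfold partialP
  have e : (fun t : ℝ => (Function.update x.2 b t) a ^ 2 - (Function.update x.2 b t) b ^ 2) =
      fun t : ℝ => x.2 a ^ 2 - t ^ 2 := by
    funext t
    rw [Function.update_self, Function.update_of_ne hab]
  rw [e]
  have hd : HasDerivAt (fun t : ℝ => x.2 a ^ 2 - t ^ 2) (-(2 * x.2 b)) (x.2 b) := by
    simpa using ((hasDerivAt_pow 2 (x.2 b)).const_sub (x.2 a ^ 2))
  exact hd.deriv

/-- `∂²_{p_a}(p_a² - p_b²) = 2` for `a ≠ b`. [folklore] -/
theorem partialP_partialP_sqDiff_left {a b : Fin N} (hab : a ≠ b) (x : PhaseSpace N) :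
    partialP a (partialP a (fun y : PhaseSpace N => y.2 a ^ 2 - y.2 b ^ 2)) x = 2 := by
  have e : partialP a (fun y : PhaseSpace N => y.2 a ^ 2 - y.2 b ^ 2) = fun y : PhaseSpace N => 2 * y.2 a :=
    funext fun y => partialP_sqDiff_left hab y
  rw [e, Literature.MathematicalPhysics.KineticTheory.HeatConduction.partialP_const_mul, partialP_momentum]
  simp

/-- `∂²_{p_b}(p_a² - p_b²) = -2` for `a ≠ b`. [folklore] -/
theorem partialP_partialP_sqDiff_right {a b : Fin N} (hab : a ≠ b) (x : PhaseSpace N) :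
    partialP b (partialP b (fun y : PhaseSpace N => y.2 a ^ 2 - y.2 b ^ 2)) x = -2 := by
  have e : partialP b (fun y : PhaseSpace N => y.2 a ^ 2 - y.2 b ^ 2) = fun y : PhaseSpace N => (-2) * y.2 b :=
    funext fun y => by rw [partialP_sqDiff_right hab y]; ring
  rw [e, Literature.MathematicalPhysics.KineticTheory.HeatConduction.partialP_const_mul, partialP_momentum]
  simp


/-! ### No smooth momentum-even adjoint solution -/

section Pinned

variable {ω₂ lam β γ : ℝ} (hω : 0 < ω₂) (hl : 0 ≤ lam) (hβ : 0 ≤ β) (hγ : 0 < γ) (hN : 2 ≤ N)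
  {T : ℝ} (hT : 0 < T)
include hω hl hβ hγ hN hT

/-- **No `C²`, momentum-even, square-integrable solution of `L† U = -φ̃`.** For the pinned chain
(`ω₂ > 0`, `lam, β ≥ 0`, `γ > 0`, `N ≥ 2`, `T > 0`): there is no `U ∈ C²` with `U(q,-p) = U(q,p)`,
`∫ U² e^{-H/T} dx < ∞` and `(L_{T,T}(U∘Θ))(Θx) = -γ(p_0² - p_{N-1}²)/(2T²)` for all `x`. Evenness splits the
equation into `{H, U} = 0` and `B U = -(p_0² - p_{N-1}²)/(2T²)`; the `L²` kernel of the two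
Ornstein–Uhlenbeck taps fixes `∂_{p_0}U = p_0/(2T²)`, `∂_{p_{N-1}}U = -p_{N-1}/(2T²)`
(`partialP_bath_eq_zero_of_bath_eq_zero`); then `U - H/(2T²)` is a `C²` first integral of the closed
chain blind to `p_0`, constant by `poisson_hamiltonian_rigidity`, contradicting
`∂_{p_{N-1}}(U - H/(2T²)) = -p_{N-1}/T²`. [folklore] -/
theorem false_of_contDiff_even_adjoint_solution {U : PhaseSpace N → ℝ} (hU : ContDiff ℝ 2 U)
    (heven : ∀ x : PhaseSpace N, U (x.1, -x.2) = U x)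
    (hU2 : Integrable (fun x => U x ^ 2 * (pinnedChain ω₂ lam β γ).gibbsDensity N T x))
    (hadj : ∀ x : PhaseSpace N,
      (pinnedChain ω₂ lam β γ).generator N T T (fun y : PhaseSpace N => U (y.1, -y.2)) (x.1, -x.2) =
        -(γ / (2 * T ^ 2) * (x.2 ⟨0, by omega⟩ ^ 2 - x.2 ⟨N - 1, by omega⟩ ^ 2))) : False := by
  set P := pinnedChain ω₂ lam β γ with hP
  have hγ' : P.γ = γ := rfl
  set b₀ : Fin N := ⟨0, by omega⟩ with hb₀
  set b₁ : Fin N := ⟨N - 1, by omega⟩ with hb₁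
  have hb : b₀ ≠ b₁ := by
    intro h
    have h' := congrArg Fin.val h
    simp only [hb₀, hb₁] at h'
    omega
  set ρ := P.gibbsDensity N T with hρ
  have hUd : Differentiable ℝ U := hU.differentiable two_ne_zero
  have hU1 : ∀ i, ContDiff ℝ 1 (partialP i U) := fun i => contDiff_partialP hU (by norm_num) i
  -- (A) `L U = -φ̃` pointwise (the reversal is trivial on the even `U`)
  have hUΘ : (fun y : PhaseSpace N => U (y.1, -y.2)) = U := funext heven
  have hA : ∀ x : PhaseSpace N, P.generator N T T U x = -(γ / (2 * T ^ 2) * (x.2 b₀ ^ 2 - x.2 b₁ ^ 2)) := by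
    intro x
    have h := hadj (x.1, -x.2)
    rw [hUΘ] at h
    simpa only [neg_neg, Prod.mk.eta, Pi.neg_apply, neg_sq] using h
  -- (B) the explicit adjoint `(L(U∘Θ))∘Θ = -{H,·}-part + γ · bath part`
  have hB : ∀ x : PhaseSpace N,
      (∑ i : Fin N, (-(x.2 i) * partialQ i U x + partialQ i (P.hamiltonian N) x * partialP i U x)) +
        P.γ * ∑ i : Fin N,
          ((if i.val = 0 then T * partialP i (partialP i U) x - x.2 i * partialP i U x else 0) +
            (if i.val = N - 1 then T * partialP i (partialP i U) x - x.2 i * partialP i U x else 0)) =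
      -(γ / (2 * T ^ 2) * (x.2 b₀ ^ 2 - x.2 b₁ ^ 2)) := by
    intro x
    rw [← generator_comp_reversal P N T T U x]
    exact hadj x
  have hneg : ∀ x : PhaseSpace N,
      ∑ i : Fin N, (-(x.2 i) * partialQ i U x + partialQ i (P.hamiltonian N) x * partialP i U x) =
        -∑ i : Fin N, (x.2 i * partialQ i U x - partialQ i (P.hamiltonian N) x * partialP i U x) := by
    intro x
    rw [← Finset.sum_neg_distrib]
    exact Finset.sum_congr rfl fun i _ => by ring
  -- the Liouville part vanishes and the bath part equals `-(p_0² - p_{N-1}²)/(2T²)`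
  have hLiou : ∀ x : PhaseSpace N,
      ∑ i : Fin N, (x.2 i * partialQ i U x - partialQ i (P.hamiltonian N) x * partialP i U x) = 0 := by
    intro x
    have h1 := hA x
    have h2 := hB x
    unfold OscillatorChain.generator at h1
    rw [hneg] at h2
    linarith
  have hBath : ∀ x : PhaseSpace N,
      (T * partialP b₀ (partialP b₀ U) x - x.2 b₀ * partialP b₀ U x) +
        (T * partialP b₁ (partialP b₁ U) x - x.2 b₁ * partialP b₁ U x) =
      -(1 / (2 * T ^ 2) * (x.2 b₀ ^ 2 - x.2 b₁ ^ 2)) := by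
    intro x
    have h1 := hA x
    have h2 := hB x
    unfold OscillatorChain.generator at h1
    rw [hneg] at h2
    rw [sum_ite_ends_eq hN (fun i => T * partialP i (partialP i U) x - x.2 i * partialP i U x), hγ'] at h1 h2
    have h3 : γ * ((T * partialP b₀ (partialP b₀ U) x - x.2 b₀ * partialP b₀ U x) +
        (T * partialP b₁ (partialP b₁ U) x - x.2 b₁ * partialP b₁ U x)) =
        γ * (-(1 / (2 * T ^ 2) * (x.2 b₀ ^ 2 - x.2 b₁ ^ 2))) := by
      have h4 : γ * ((T * partialP b₀ (partialP b₀ U) x - x.2 b₀ * partialP b₀ U x) +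
          (T * partialP b₁ (partialP b₁ U) x - x.2 b₁ * partialP b₁ U x)) =
          -(γ / (2 * T ^ 2) * (x.2 b₀ ^ 2 - x.2 b₁ ^ 2)) := by linarith
      rw [h4]
      ring
    exact mul_left_cancel₀ hγ.ne' h3
  -- (C) `V = U - E/(4T²)`, `E = p_0² - p_{N-1}²`, solves `B V = 0`
  set E : PhaseSpace N → ℝ := fun y => y.2 b₀ ^ 2 - y.2 b₁ ^ 2 with hE
  have hEs : ContDiff ℝ 2 E := ((contDiff_momentum b₀).pow 2).sub ((contDiff_momentum b₁).pow 2)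
  have hEd : Differentiable ℝ E := hEs.differentiable two_ne_zero
  have hE1 : ∀ i, ContDiff ℝ 1 (partialP i E) := fun i => contDiff_partialP hEs (by norm_num) i
  set c : ℝ := (4 * T ^ 2)⁻¹ with hc
  set V : PhaseSpace N → ℝ := U + fun y => (-c) * E y with hV
  have hVs : ContDiff ℝ 2 V := hU.add (contDiff_const.mul hEs)
  have hV1 : ∀ i x, partialP i V x = partialP i U x + (-c) * partialP i E x := by
    intro i x
    rw [hV, Literature.MathematicalPhysics.KineticTheory.HeatConduction.partialP_add hUd (hEd.const_mul (-c)),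
      Literature.MathematicalPhysics.KineticTheory.HeatConduction.partialP_const_mul]
  have hV2 : ∀ i x, partialP i (partialP i V) x =
      partialP i (partialP i U) x + (-c) * partialP i (partialP i E) x := by
    intro i x
    have e : partialP i V = partialP i U + fun y => (-c) * partialP i E y := funext (hV1 i)
    rw [e, Literature.MathematicalPhysics.KineticTheory.HeatConduction.partialP_add
        ((hU1 i).differentiable one_ne_zero) (((hE1 i).differentiable one_ne_zero).const_mul (-c)),
      Literature.MathematicalPhysics.KineticTheory.HeatConduction.partialP_const_mul]
  have hbathV : ∀ x : PhaseSpace N,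
      (T * partialP b₀ (partialP b₀ V) x - x.2 b₀ * partialP b₀ V x) +
        (T * partialP b₁ (partialP b₁ V) x - x.2 b₁ * partialP b₁ V x) = 0 := by
    intro x
    rw [hV2 b₀ x, hV2 b₁ x, hV1 b₀ x, hV1 b₁ x, partialP_partialP_sqDiff_left hb,
      partialP_partialP_sqDiff_right hb, partialP_sqDiff_left hb, partialP_sqDiff_right hb]
    have h := hBath x
    rw [hc]
    linear_combination h
  -- `V ∈ L²(e^{-H/T} dx)`
  have hV2i : Integrable (fun x => V x ^ 2 * ρ x) := by
    have i0 := pinnedChain_integrable_momentum_pow_mul_gibbsDensity hω hl hβ γ N hT b₀ (k := 4) le_rfl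
    have i1 := pinnedChain_integrable_momentum_pow_mul_gibbsDensity hω hl hβ γ N hT b₁ (k := 4) le_rfl
    have hmaj : Integrable fun x => 2 * (U x ^ 2 * ρ x) + 4 * c ^ 2 * (x.2 b₀ ^ 4 * ρ x) +
        4 * c ^ 2 * (x.2 b₁ ^ 4 * ρ x) :=
      ((hU2.const_mul 2).add (i0.const_mul _)).add (i1.const_mul _)
    refine hmaj.mono' ((hVs.continuous.pow 2).mul
      (pinnedChain_continuous_gibbsDensity ω₂ lam β γ N T)).aestronglyMeasurable
      (Eventually.of_forall fun x => ?_)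
    have hρ0 : 0 ≤ ρ x := (P.gibbsDensity_pos N T x).le
    rw [Real.norm_eq_abs, abs_of_nonneg (mul_nonneg (sq_nonneg _) hρ0)]
    have hVx : V x = U x + (-c) * (x.2 b₀ ^ 2 - x.2 b₁ ^ 2) := rfl
    rw [hVx]
    have h1 : (U x + (-c) * (x.2 b₀ ^ 2 - x.2 b₁ ^ 2)) ^ 2 ≤
        2 * U x ^ 2 + 4 * c ^ 2 * x.2 b₀ ^ 4 + 4 * c ^ 2 * x.2 b₁ ^ 4 := by
      nlinarith [sq_nonneg (U x - (-c) * (x.2 b₀ ^ 2 - x.2 b₁ ^ 2)),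
        sq_nonneg (c * (x.2 b₀ ^ 2 + x.2 b₁ ^ 2)), sq_nonneg c, sq_nonneg (x.2 b₀), sq_nonneg (x.2 b₁)]
    have := mul_le_mul_of_nonneg_right h1 hρ0
    nlinarith
  -- (D) the `L²` kernel of the two taps: `∂_{p_0} V = ∂_{p_{N-1}} V = 0`
  have hD := partialP_bath_eq_zero_of_bath_eq_zero hω hl hβ hN hT hVs hV2i hbathV
  have hD0 : ∀ x : PhaseSpace N, partialP b₀ U x = x.2 b₀ / (2 * T ^ 2) := by
    intro x
    have h := hD b₀ (Or.inl rfl) x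
    rw [hV1, partialP_sqDiff_left hb, hc] at h
    linear_combination h
  have hD1 : ∀ x : PhaseSpace N, partialP b₁ U x = -(x.2 b₁ / (2 * T ^ 2)) := by
    intro x
    have h := hD b₁ (Or.inr rfl) x
    rw [hV1, partialP_sqDiff_right hb, hc] at h
    linear_combination h
  -- (E) rigidity for the first integral `W = U - H/(2T²)` of the closed chain
  have hHs : ContDiff ℝ 2 (P.hamiltonian N) := pinnedChain_contDiff_hamiltonian ω₂ lam β γ N
  have hHd : Differentiable ℝ (P.hamiltonian N) := hHs.differentiable two_ne_zero
  set d : ℝ := (2 * T ^ 2)⁻¹ with hd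
  set W : PhaseSpace N → ℝ := U + fun y => (-d) * P.hamiltonian N y with hW
  have hWs : ContDiff ℝ 2 W := hU.add (contDiff_const.mul hHs)
  have hW1 : ∀ i z, partialP i W z = partialP i U z + (-d) * z.2 i := by
    intro i z
    rw [hW, Literature.MathematicalPhysics.KineticTheory.HeatConduction.partialP_add hUd (hHd.const_mul (-d)),
      Literature.MathematicalPhysics.KineticTheory.HeatConduction.partialP_const_mul,
      OscillatorChain.partialP_hamiltonian]
  have hHW : ∀ z, poisson (P.hamiltonian N) W z = 0 := by
    intro z
    rw [hW, poisson_add_right _ hUd (hHd.const_mul (-d)), poisson_const_mul_right, poisson_self,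
      mul_zero, add_zero]
    unfold poisson
    rw [← hLiou z]
    exact Finset.sum_congr rfl fun i _ => by rw [OscillatorChain.partialP_hamiltonian]
  have hW0 : ∀ i : Fin N, i.val = 0 → ∀ z, partialP i W z = 0 := by
    intro i hi z
    have ei : i = b₀ := Fin.ext hi
    rw [ei, hW1, hD0, hd]
    ring
  have key := (poisson_hamiltonian_rigidity ω₂ lam hβ γ hWs hHW hW0 b₁
    ((fun _ => 0, fun _ => 1) : PhaseSpace N)).1
  rw [hW1, hD1, hd] at key
  have hpt : ((fun _ => 0, fun _ => 1) : PhaseSpace N).2 b₁ = 1 := rfl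
  rw [hpt] at key
  have hinv : (T ^ 2)⁻¹ = 0 := by linear_combination -key
  exact absurd hinv (inv_ne_zero (by positivity))

end Pinned

/-! ### Registered helper sub-goal (stub form, one line) -/

/-- Registered helper sub-goal `helper_noisyPositiveNoEvenAdjointSolution` of stub `stub_noisyPositive`
(= `false_of_contDiff_even_adjoint_solution` in stub form, the two bath sites `a = 0`, `b = N - 1` passed by
value): no `C²`, momentum-even, square-integrable pointwise solution of `L† U = -γ(p_0² - p_{N-1}²)/(2T²)`. -/
theorem helper_noisyPositiveNoEvenAdjointSolution : ∀ ω₂ lam β γ : ℝ, 0 < ω₂ → 0 ≤ lam → 0 ≤ β → 0 < γ → ∀ (N : ℕ), 2 ≤ N → ∀ (T : ℝ), 0 < T → ∀ (a b : Fin N), a.val = 0 → b.val = N - 1 → ∀ U : Literature.MathematicalPhysics.KineticTheory.HeatConduction.PhaseSpace N → ℝ, ContDiff ℝ 2 U → (∀ x : Literature.MathematicalPhysics.KineticTheory.HeatConduction.PhaseSpace N, U (x.1, -x.2) = U x) → MeasureTheory.Integrable (fun x : Literature.MathematicalPhysics.KineticTheory.HeatConduction.PhaseSpace N => U x ^ 2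 * (Literature.MathematicalPhysics.KineticTheory.HeatConduction.pinnedChain ω₂ lam β γ).gibbsDensity N T x) → (∀ x : Literature.MathematicalPhysics.KineticTheory.HeatConduction.PhaseSpace N, (Literature.MathematicalPhysics.KineticTheory.HeatConduction.pinnedChain ω₂ lam β γ).generator N T T (fun y : Literature.MathematicalPhysics.KineticTheory.HeatConduction.PhaseSpace N => U (y.1, -y.2)) (x.1, -x.2) = -(γ / (2 * T ^ 2) * (x.2 a ^ 2 - x.2 b ^ 2))) → False := by
  intro ω₂ lam β γ hω hl hβ hγ N hN T hT a b ha hb U hU heven hU2 hadj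
  obtain ⟨av, hav⟩ := a
  obtain ⟨bv, hbv⟩ := b
  simp only at ha hb
  subst ha hb
  exact false_of_contDiff_even_adjoint_solution hω hl hβ hγ hN hT hU heven hU2 hadj

end Summit.AtomisticToContinuum.FouriersLaw.Theorems.NoiseLocality.StubNoisyPositive

end
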